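import Summits.HodgeConjecture.HodgeConjecture.Theorems.R90S6GLPieriCountMaster   -- L3 FILE 1: the master count `Σ_{#S=n−r} [μ ~ (λ∘rev) − ε_S]·q^{c(S)}` (all `n`, `r`)
import HarnessLib

/-!
# R90 · S6 — card L3, FILE 2: the GL₃ Pieri counts (`n = 3`, `r ∈ {1, 2}`), explicit values (row E1.4.4.2.3, count half of W10-f)

Seat `R90-C14-p10 (g0)`, helper for `stmt-HodgeConjecture-24833` (h413). Junction letter agreed with `R90-C14-p06 (g0)` (R90 bus 2026-09-05
01:00Z/01:04Z), NO new definition: for `K₀ = glInt 3 K`, `t_r = heckeDiag 3 ϖ r`, `ϖ^λ = zpowDiagGL λ` and ANTITONE `λ, μ : Fin 3 → ℤ`,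

  `pieriCount r μ λ = ({γ ∈ K₀·(t_rK₀) | (γ.out⁻¹ ϖ^λ)K₀ ∈ K₀·(ϖ^μK₀)}).ncard`

= the coefficient of `c_λ` in `c_μ·T_r` (p06's (H.0)) = `#{Λ′ : Λ₀ ⊋ Λ′ ⊋ ϖΛ₀, Λ₀/Λ′ ≅ 𝓀^r, relPos(Λ′, ϖ^λΛ₀) = μ}` (FILE 1 §4).
Evaluating FILE 1's master sum over the three pivot sets `S ⊆ Fin 3` (`q = #𝓀`, `e_i = Pi.single i 1`):

* `r = 1` (§2): `pieriCount 1 μ λ = [μ = λ−e₂]·(q² + [λ₁=λ₂]·q + [λ₀=λ₁=λ₂]) + [μ = λ−e₁]·(q + [λ₀=λ₁]) + [μ = λ−e₀]·1`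
  (`ncard_pieri_one_eq`; the `μ`-centric tables `λ = μ + e_i ↦ …` and the vanishing off the strips are FILE 3 `R90S6GLThreePieriTables`);
* `r = 2` (§2): `pieriCount 2 μ λ = [μ = λ−e₁−e₂]·(q² + [λ₀=λ₁]·q + [λ₀=λ₁=λ₂]) + [μ = λ−e₀−e₂]·(q + [λ₁=λ₂]) + [μ = λ−e₀−e₁]·1`
  (`ncard_pieri_two_eq`).

These are Macdonald's `g^λ_{μ(1^r)}(q)` (II (4.6)) at `n = 3`; kill-checks (dealer l.6880): `T₁·T₁ = c_{(2,0,0)} + (q+1)c_{(1,1,0)}`,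
`T₁·T₂ = c_{(2,1,0)} + (q²+q+1)c_{(1,1,1)}` (`μ = (1,0,0)`: `λ = (2,0,0) ↦ 1`, `(1,1,0) ↦ q+1`; `λ = (2,1,0) ↦ 1`, `(1,1,1) ↦ q²+q+1`).

## References
* [Macdonald1995] I. G. Macdonald, *Symmetric Functions and Hall Polynomials*, 2nd ed. (1995), Ch. II (4.2)–(4.6) (PDF p. 164), Ch. V (2.6).
* [ShimuraIATAF1971] G. Shimura, *Introduction to the Arithmetic Theory of Automorphic Functions* (1971), §3.2, Lemma 3.22.
-/

set_option autoImplicit false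
-- the mandated namespace repeats the single-problem summit's segment (`HodgeConjecture.HodgeConjecture`)
set_option linter.dupNamespace false

noncomputable section

open scoped MatrixGroups
open MulAction ValuativeRel Matrix Finset Literature.NumberTheory.Automorphic Literature.NumberTheory.Automorphic.Echelon
  Literature.LinearAlgebra.Matrix.Echelon

namespace Summit.HodgeConjecture.HodgeConjecture.R90.S6

/-! ## §0 Combinatorics of exponent vectors on `Fin 3` -/

section Comb

/-- Antitone triples: `f` is antitone iff `f 1 ≤ f 0` and `f 2 ≤ f 1`. [folklore] -/
theorem antitone_fin_three_iff {f : Fin 3 → ℤ} : Antitone f ↔ f 1 ≤ f 0 ∧ f 2 ≤ f 1 := by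
  constructor
  · intro h
    exact ⟨h (by decide : (0 : Fin 3) ≤ 1), h (by decide : (1 : Fin 3) ≤ 2)⟩
  · rintro ⟨h1, h2⟩ i j hij
    fin_cases i <;> fin_cases j <;> simp at hij ⊢ <;> omega

/-- Two triples are equal iff their three values agree. [folklore] -/
theorem fun_eq_iff_fin_three {f g : Fin 3 → ℤ} : f = g ↔ f 0 = g 0 ∧ f 1 = g 1 ∧ f 2 = g 2 := by
  constructor
  · rintro rfl
    exact ⟨rfl, rfl, rfl⟩
  · rintro ⟨h0, h1, h2⟩
    funext i
    fin_cases i <;> assumption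

/-- Two ANTITONE tuples that are permutations of each other are equal (`Tuple.unique_antitone`). [folklore] -/
theorem eq_of_exists_perm_of_antitone {m : ℕ} {a b : Fin m → ℤ} (ha : Antitone a) (hb : Antitone b)
    (h : ∃ σ : Equiv.Perm (Fin m), ∀ i, b (σ i) = a i) : b = a := by
  obtain ⟨σ, hσ⟩ := h
  have h1 : b ∘ σ = a := funext hσ
  have hb' : Antitone (b ∘ ⇑(Equiv.refl (Fin m))) := hb
  have h2 := Tuple.unique_antitone (h1 ▸ ha : Antitone (b ∘ σ)) hb'
  rw [h1] at h2
  exact h2.symm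

/-- Re-indexing the target by a fixed permutation `τ`: `μ ~ f` iff `μ ~ c` when `f = c ∘ τ`. [folklore] -/
theorem exists_perm_iff_of_comp {m : ℕ} {μ f c : Fin m → ℤ} (τ : Equiv.Perm (Fin m)) (hf : ∀ i, f i = c (τ i)) :
    (∃ σ : Equiv.Perm (Fin m), ∀ i, μ (σ i) = f i) ↔ ∃ σ : Equiv.Perm (Fin m), ∀ i, μ (σ i) = c i := by
  constructor
  · rintro ⟨σ, hσ⟩
    refine ⟨σ * τ⁻¹, fun i => ?_⟩
    rw [Equiv.Perm.mul_apply, hσ, hf, Equiv.Perm.inv_def, Equiv.apply_symm_apply]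
  · rintro ⟨σ, hσ⟩
    refine ⟨σ * τ, fun i => ?_⟩
    rw [Equiv.Perm.mul_apply, hσ, hf]

/-- For antitone `μ` and an antitone target `c`: `μ ~ c ⟺ μ = c`. [folklore] -/
theorem exists_perm_iff_eq_of_antitone {m : ℕ} {μ c : Fin m → ℤ} (hμ : Antitone μ) (hc : Antitone c) :
    (∃ σ : Equiv.Perm (Fin m), ∀ i, μ (σ i) = c i) ↔ μ = c :=
  ⟨fun h => eq_of_exists_perm_of_antitone hc hμ h, fun h => ⟨1, fun i => by rw [h, Equiv.Perm.one_apply]⟩⟩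

/-- The pivot sets of size `2` in `Fin 3`. [folklore] -/
private theorem filter_card_eq_two_fin_three :
    ((Finset.univ : Finset (Finset (Fin 3))).filter fun S => S.card = 3 - 1) = {{1, 2}, {0, 2}, {0, 1}} := by decide

/-- The pivot sets of size `1` in `Fin 3`. [folklore] -/
private theorem filter_card_eq_one_fin_three :
    ((Finset.univ : Finset (Finset (Fin 3))).filter fun S => S.card = 3 - 2) = {{2}, {1}, {0}} := by decide

/-- `c(S) = #echelonPositions S` for the six pivot sets. [folklore] -/
private theorem card_echelonPositions_fin_three :
    (echelonPositions ({1, 2} : Finset (Fin 3))).card = 2 ∧ (echelonPositions ({0, 2} : Finset (Fin 3))).card = 1 ∧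
      (echelonPositions ({0, 1} : Finset (Fin 3))).card = 0 ∧ (echelonPositions ({2} : Finset (Fin 3))).card = 2 ∧
      (echelonPositions ({1} : Finset (Fin 3))).card = 1 ∧ (echelonPositions ({0} : Finset (Fin 3))).card = 0 := by decide

end Comb

/-! ## §1 The bracket form: the master sum evaluated over the three pivot sets -/

section Brackets

variable {K : Type*} [Field K] [ValuativeRel K] [IsDiscreteValuationRing 𝒪[K]] [Finite 𝓀[K]] {ϖ : K}

/-- **`r = 1`, BRACKET FORM** (`λ` antitone, `μ` arbitrary): `pieriCount 1 μ λ = [μ ~ λ−e₂]·q² + [μ ~ λ−e₁]·q + [μ ~ λ−e₀]·1`, `~` = «is a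
permutation of» — FILE 1's master sum over the pivot sets `{1,2}, {0,2}, {0,1}` (weights `q², q, 1`). [cite: Macdonald1995, Ch. II (4.6); Ch. V (2.6)] -/
theorem ncard_pieri_one_eq_brackets (hϖ : IsUniformizingElement ϖ) {lam : Fin 3 → ℤ} (hlam : Antitone lam) (μ : Fin 3 → ℤ) :
    {γ ∈ MulAction.orbit (glInt 3 K) (((heckeDiag 3 (Units.mk0 ϖ hϖ.ne_zero) 1 : GL (Fin 3) K)) : GL (Fin 3) K ⧸ glInt 3 K) |
        ((((γ.out)⁻¹ * zpowDiagGL hϖ.ne_zero lam : GL (Fin 3) K)) : GL (Fin 3) K ⧸ glInt 3 K) ∈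
          MulAction.orbit (glInt 3 K) (((zpowDiagGL hϖ.ne_zero μ : GL (Fin 3) K)) : GL (Fin 3) K ⧸ glInt 3 K)}.ncard =
      (if ∃ σ : Equiv.Perm (Fin 3), ∀ i, μ (σ i) = (lam - Pi.single 2 1 : Fin 3 → ℤ) i then Nat.card 𝓀[K] ^ 2 else 0) +
      (if ∃ σ : Equiv.Perm (Fin 3), ∀ i, μ (σ i) = (lam - Pi.single 1 1 : Fin 3 → ℤ) i then Nat.card 𝓀[K] else 0) +
      (if ∃ σ : Equiv.Perm (Fin 3), ∀ i, μ (σ i) = (lam - Pi.single 0 1 : Fin 3 → ℤ) i then 1 else 0) := by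
  classical
  obtain ⟨c12, c02, c01, -, -, -⟩ := card_echelonPositions_fin_three
  rw [ncard_pieri_eq_sum_of_antitone hϖ (by norm_num) hlam μ, filter_card_eq_two_fin_three,
    Finset.sum_insert (by decide), Finset.sum_insert (by decide), Finset.sum_singleton, c12, c02, c01, pow_one, pow_zero]
  have r0 : Fin.rev (0 : Fin 3) = 2 := by decide
  have r1 : Fin.rev (1 : Fin 3) = 1 := by decide
  have r2 : Fin.rev (2 : Fin 3) = 0 := by decide
  have h2 : (∃ σ : Equiv.Perm (Fin 3), ∀ i, μ (σ i) = lam (Fin.rev i) - (epsOf ({1, 2} : Finset (Fin 3)) i : ℤ)) ↔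
      ∃ σ : Equiv.Perm (Fin 3), ∀ i, μ (σ i) = (lam - Pi.single 2 1 : Fin 3 → ℤ) i :=
    exists_perm_iff_of_comp Fin.revPerm fun i => by
      fin_cases i <;> simp [epsOf, r0, r1, r2]
  have h1 : (∃ σ : Equiv.Perm (Fin 3), ∀ i, μ (σ i) = lam (Fin.rev i) - (epsOf ({0, 2} : Finset (Fin 3)) i : ℤ)) ↔
      ∃ σ : Equiv.Perm (Fin 3), ∀ i, μ (σ i) = (lam - Pi.single 1 1 : Fin 3 → ℤ) i :=
    exists_perm_iff_of_comp Fin.revPerm fun i => by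
      fin_cases i <;> simp [epsOf, r0, r1, r2]
  have h0 : (∃ σ : Equiv.Perm (Fin 3), ∀ i, μ (σ i) = lam (Fin.rev i) - (epsOf ({0, 1} : Finset (Fin 3)) i : ℤ)) ↔
      ∃ σ : Equiv.Perm (Fin 3), ∀ i, μ (σ i) = (lam - Pi.single 0 1 : Fin 3 → ℤ) i :=
    exists_perm_iff_of_comp Fin.revPerm fun i => by
      fin_cases i <;> simp [epsOf, r0, r1, r2]
  rw [if_congr h2 rfl rfl, if_congr h1 rfl rfl, if_congr h0 rfl rfl, add_assoc]

/-- **`r = 2`, BRACKET FORM** (`λ` antitone, `μ` arbitrary): `pieriCount 2 μ λ = [μ ~ λ−e₁−e₂]·q² + [μ ~ λ−e₀−e₂]·q + [μ ~ λ−e₀−e₁]·1`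
(pivot sets `{2}, {1}, {0}`, weights `q², q, 1`). [cite: Macdonald1995, Ch. II (4.6); Ch. V (2.6)] -/
theorem ncard_pieri_two_eq_brackets (hϖ : IsUniformizingElement ϖ) {lam : Fin 3 → ℤ} (hlam : Antitone lam) (μ : Fin 3 → ℤ) :
    {γ ∈ MulAction.orbit (glInt 3 K) (((heckeDiag 3 (Units.mk0 ϖ hϖ.ne_zero) 2 : GL (Fin 3) K)) : GL (Fin 3) K ⧸ glInt 3 K) |
        ((((γ.out)⁻¹ * zpowDiagGL hϖ.ne_zero lam : GL (Fin 3) K)) : GL (Fin 3) K ⧸ glInt 3 K) ∈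
          MulAction.orbit (glInt 3 K) (((zpowDiagGL hϖ.ne_zero μ : GL (Fin 3) K)) : GL (Fin 3) K ⧸ glInt 3 K)}.ncard =
      (if ∃ σ : Equiv.Perm (Fin 3), ∀ i, μ (σ i) = (lam - Pi.single 1 1 - Pi.single 2 1 : Fin 3 → ℤ) i then Nat.card 𝓀[K] ^ 2 else 0) +
      (if ∃ σ : Equiv.Perm (Fin 3), ∀ i, μ (σ i) = (lam - Pi.single 0 1 - Pi.single 2 1 : Fin 3 → ℤ) i then Nat.card 𝓀[K] else 0) +
      (if ∃ σ : Equiv.Perm (Fin 3), ∀ i, μ (σ i) = (lam - Pi.single 0 1 - Pi.single 1 1 : Fin 3 → ℤ) i then 1 else 0) := by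
  classical
  obtain ⟨-, -, -, c2, c1, c0⟩ := card_echelonPositions_fin_three
  rw [ncard_pieri_eq_sum_of_antitone hϖ (by norm_num) hlam μ, filter_card_eq_one_fin_three,
    Finset.sum_insert (by decide), Finset.sum_insert (by decide), Finset.sum_singleton, c2, c1, c0, pow_one, pow_zero]
  have r0 : Fin.rev (0 : Fin 3) = 2 := by decide
  have r1 : Fin.rev (1 : Fin 3) = 1 := by decide
  have r2 : Fin.rev (2 : Fin 3) = 0 := by decide
  have h12 : (∃ σ : Equiv.Perm (Fin 3), ∀ i, μ (σ i) = lam (Fin.rev i) - (epsOf ({2} : Finset (Fin 3)) i : ℤ)) ↔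
      ∃ σ : Equiv.Perm (Fin 3), ∀ i, μ (σ i) = (lam - Pi.single 1 1 - Pi.single 2 1 : Fin 3 → ℤ) i :=
    exists_perm_iff_of_comp Fin.revPerm fun i => by
      fin_cases i <;> simp [epsOf, r0, r1, r2]
  have h02 : (∃ σ : Equiv.Perm (Fin 3), ∀ i, μ (σ i) = lam (Fin.rev i) - (epsOf ({1} : Finset (Fin 3)) i : ℤ)) ↔
      ∃ σ : Equiv.Perm (Fin 3), ∀ i, μ (σ i) = (lam - Pi.single 0 1 - Pi.single 2 1 : Fin 3 → ℤ) i :=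
    exists_perm_iff_of_comp Fin.revPerm fun i => by
      fin_cases i <;> simp [epsOf, r0, r1, r2]
  have h01 : (∃ σ : Equiv.Perm (Fin 3), ∀ i, μ (σ i) = lam (Fin.rev i) - (epsOf ({0} : Finset (Fin 3)) i : ℤ)) ↔
      ∃ σ : Equiv.Perm (Fin 3), ∀ i, μ (σ i) = (lam - Pi.single 0 1 - Pi.single 1 1 : Fin 3 → ℤ) i :=
    exists_perm_iff_of_comp Fin.revPerm fun i => by
      fin_cases i <;> simp [epsOf, r0, r1, r2]
  rw [if_congr h12 rfl rfl, if_congr h02 rfl rfl, if_congr h01 rfl rfl, add_assoc]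

end Brackets

/-! ## §2 Sorting the targets (antitone `μ`): closed forms -/

section Sorting

variable {lam μ : Fin 3 → ℤ}

/-- `λ − e₂` is antitone and `μ ~ λ−e₂ ⟺ μ = λ−e₂`. [folklore] -/
private theorem perm_sub_single_two_iff (hlam : Antitone lam) (hμ : Antitone μ) :
    (∃ σ : Equiv.Perm (Fin 3), ∀ i, μ (σ i) = (lam - Pi.single 2 1 : Fin 3 → ℤ) i) ↔ μ = lam - Pi.single 2 1 := by
  have h := antitone_fin_three_iff.1 hlam
  exact exists_perm_iff_eq_of_antitone hμ (antitone_fin_three_iff.2 (by simp; omega))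

/-- `λ₁ > λ₂`: `μ ~ λ−e₁ ⟺ μ = λ−e₁`. [folklore] -/
private theorem perm_sub_single_one_iff_of_ne (hlam : Antitone lam) (hμ : Antitone μ) (h12 : lam 1 ≠ lam 2) :
    (∃ σ : Equiv.Perm (Fin 3), ∀ i, μ (σ i) = (lam - Pi.single 1 1 : Fin 3 → ℤ) i) ↔ μ = lam - Pi.single 1 1 := by
  have h := antitone_fin_three_iff.1 hlam
  exact exists_perm_iff_eq_of_antitone hμ (antitone_fin_three_iff.2 (by simp; omega))

/-- `λ₁ = λ₂`: `λ−e₁` sorts to `λ−e₂`, so `μ ~ λ−e₁ ⟺ μ = λ−e₂`. [folklore] -/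
private theorem perm_sub_single_one_iff_of_eq (hlam : Antitone lam) (hμ : Antitone μ) (h12 : lam 1 = lam 2) :
    (∃ σ : Equiv.Perm (Fin 3), ∀ i, μ (σ i) = (lam - Pi.single 1 1 : Fin 3 → ℤ) i) ↔ μ = lam - Pi.single 2 1 := by
  rw [exists_perm_iff_of_comp (Equiv.swap 1 2) (c := (lam - Pi.single 2 1 : Fin 3 → ℤ)) (fun i => by
    fin_cases i <;> simp [Equiv.swap_apply_def] <;> omega)]
  exact perm_sub_single_two_iff hlam hμ

/-- `λ₀ > λ₁`: `μ ~ λ−e₀ ⟺ μ = λ−e₀`. [folklore] -/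
private theorem perm_sub_single_zero_iff_of_ne (hlam : Antitone lam) (hμ : Antitone μ) (h01 : lam 0 ≠ lam 1) :
    (∃ σ : Equiv.Perm (Fin 3), ∀ i, μ (σ i) = (lam - Pi.single 0 1 : Fin 3 → ℤ) i) ↔ μ = lam - Pi.single 0 1 := by
  have h := antitone_fin_three_iff.1 hlam
  exact exists_perm_iff_eq_of_antitone hμ (antitone_fin_three_iff.2 (by simp; omega))

/-- `λ₀ = λ₁ > λ₂`: `λ−e₀` sorts to `λ−e₁`. [folklore] -/
private theorem perm_sub_single_zero_iff_of_eq_of_ne (hlam : Antitone lam) (hμ : Antitone μ) (h01 : lam 0 = lam 1) (h12 : lam 1 ≠ lam 2) :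
    (∃ σ : Equiv.Perm (Fin 3), ∀ i, μ (σ i) = (lam - Pi.single 0 1 : Fin 3 → ℤ) i) ↔ μ = lam - Pi.single 1 1 := by
  rw [exists_perm_iff_of_comp (Equiv.swap 0 1) (c := (lam - Pi.single 1 1 : Fin 3 → ℤ)) (fun i => by
    fin_cases i <;> simp [Equiv.swap_apply_def] <;> omega)]
  exact perm_sub_single_one_iff_of_ne hlam hμ h12

/-- `λ₀ = λ₁ = λ₂`: `λ−e₀` sorts to `λ−e₂`. [folklore] -/
private theorem perm_sub_single_zero_iff_of_eq_of_eq (hlam : Antitone lam) (hμ : Antitone μ) (h01 : lam 0 = lam 1) (h12 : lam 1 = lam 2) :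
    (∃ σ : Equiv.Perm (Fin 3), ∀ i, μ (σ i) = (lam - Pi.single 0 1 : Fin 3 → ℤ) i) ↔ μ = lam - Pi.single 2 1 := by
  rw [exists_perm_iff_of_comp (Equiv.swap 0 1 * Equiv.swap 0 2) (c := (lam - Pi.single 2 1 : Fin 3 → ℤ)) (fun i => by
    fin_cases i <;> simp [Equiv.swap_apply_def, Equiv.Perm.mul_apply] <;> omega)]
  exact perm_sub_single_two_iff hlam hμ

/-- `λ − e₁ − e₂` is antitone: `μ ~ λ−e₁−e₂ ⟺ μ = λ−e₁−e₂`. [folklore] -/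
private theorem perm_sub_single_one_two_iff (hlam : Antitone lam) (hμ : Antitone μ) :
    (∃ σ : Equiv.Perm (Fin 3), ∀ i, μ (σ i) = (lam - Pi.single 1 1 - Pi.single 2 1 : Fin 3 → ℤ) i) ↔
      μ = lam - Pi.single 1 1 - Pi.single 2 1 := by
  have h := antitone_fin_three_iff.1 hlam
  exact exists_perm_iff_eq_of_antitone hμ (antitone_fin_three_iff.2 (by simp; omega))

/-- `λ₀ > λ₁`: `μ ~ λ−e₀−e₂ ⟺ μ = λ−e₀−e₂`. [folklore] -/
private theorem perm_sub_single_zero_two_iff_of_ne (hlam : Antitone lam) (hμ : Antitone μ) (h01 : lam 0 ≠ lam 1) :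
    (∃ σ : Equiv.Perm (Fin 3), ∀ i, μ (σ i) = (lam - Pi.single 0 1 - Pi.single 2 1 : Fin 3 → ℤ) i) ↔
      μ = lam - Pi.single 0 1 - Pi.single 2 1 := by
  have h := antitone_fin_three_iff.1 hlam
  exact exists_perm_iff_eq_of_antitone hμ (antitone_fin_three_iff.2 (by simp; omega))

/-- `λ₀ = λ₁`: `λ−e₀−e₂` sorts to `λ−e₁−e₂`. [folklore] -/
private theorem perm_sub_single_zero_two_iff_of_eq (hlam : Antitone lam) (hμ : Antitone μ) (h01 : lam 0 = lam 1) :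
    (∃ σ : Equiv.Perm (Fin 3), ∀ i, μ (σ i) = (lam - Pi.single 0 1 - Pi.single 2 1 : Fin 3 → ℤ) i) ↔
      μ = lam - Pi.single 1 1 - Pi.single 2 1 := by
  rw [exists_perm_iff_of_comp (Equiv.swap 0 1) (c := (lam - Pi.single 1 1 - Pi.single 2 1 : Fin 3 → ℤ)) (fun i => by
    fin_cases i <;> simp [Equiv.swap_apply_def] <;> omega)]
  exact perm_sub_single_one_two_iff hlam hμ

/-- `λ₁ > λ₂`: `μ ~ λ−e₀−e₁ ⟺ μ = λ−e₀−e₁`. [folklore] -/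
private theorem perm_sub_single_zero_one_iff_of_ne (hlam : Antitone lam) (hμ : Antitone μ) (h12 : lam 1 ≠ lam 2) :
    (∃ σ : Equiv.Perm (Fin 3), ∀ i, μ (σ i) = (lam - Pi.single 0 1 - Pi.single 1 1 : Fin 3 → ℤ) i) ↔
      μ = lam - Pi.single 0 1 - Pi.single 1 1 := by
  have h := antitone_fin_three_iff.1 hlam
  exact exists_perm_iff_eq_of_antitone hμ (antitone_fin_three_iff.2 (by simp; omega))

/-- `λ₁ = λ₂ < λ₀`: `λ−e₀−e₁` sorts to `λ−e₀−e₂`. [folklore] -/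
private theorem perm_sub_single_zero_one_iff_of_eq_of_ne (hlam : Antitone lam) (hμ : Antitone μ) (h12 : lam 1 = lam 2)
    (h01 : lam 0 ≠ lam 1) :
    (∃ σ : Equiv.Perm (Fin 3), ∀ i, μ (σ i) = (lam - Pi.single 0 1 - Pi.single 1 1 : Fin 3 → ℤ) i) ↔
      μ = lam - Pi.single 0 1 - Pi.single 2 1 := by
  rw [exists_perm_iff_of_comp (Equiv.swap 1 2) (c := (lam - Pi.single 0 1 - Pi.single 2 1 : Fin 3 → ℤ)) (fun i => by
    fin_cases i <;> simp [Equiv.swap_apply_def] <;> omega)]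
  exact perm_sub_single_zero_two_iff_of_ne hlam hμ h01

/-- `λ₀ = λ₁ = λ₂`: `λ−e₀−e₁` sorts to `λ−e₁−e₂`. [folklore] -/
private theorem perm_sub_single_zero_one_iff_of_eq_of_eq (hlam : Antitone lam) (hμ : Antitone μ) (h12 : lam 1 = lam 2)
    (h01 : lam 0 = lam 1) :
    (∃ σ : Equiv.Perm (Fin 3), ∀ i, μ (σ i) = (lam - Pi.single 0 1 - Pi.single 1 1 : Fin 3 → ℤ) i) ↔
      μ = lam - Pi.single 1 1 - Pi.single 2 1 := by
  rw [exists_perm_iff_of_comp (Equiv.swap 0 2 * Equiv.swap 0 1) (c := (lam - Pi.single 1 1 - Pi.single 2 1 : Fin 3 → ℤ))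
    (fun i => by fin_cases i <;> simp [Equiv.swap_apply_def, Equiv.Perm.mul_apply] <;> omega)]
  exact perm_sub_single_one_two_iff hlam hμ

/-- Scalar form of `μ = λ − e₂`. [folklore] -/
theorem eq_sub_single_two_iff : μ = lam - Pi.single 2 1 ↔ μ 0 = lam 0 ∧ μ 1 = lam 1 ∧ μ 2 = lam 2 - 1 := by
  rw [fun_eq_iff_fin_three]; simp

/-- Scalar form of `μ = λ − e₁`. [folklore] -/
theorem eq_sub_single_one_iff : μ = lam - Pi.single 1 1 ↔ μ 0 = lam 0 ∧ μ 1 = lam 1 - 1 ∧ μ 2 = lam 2 := by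
  rw [fun_eq_iff_fin_three]; simp

/-- Scalar form of `μ = λ − e₀`. [folklore] -/
theorem eq_sub_single_zero_iff : μ = lam - Pi.single 0 1 ↔ μ 0 = lam 0 - 1 ∧ μ 1 = lam 1 ∧ μ 2 = lam 2 := by
  rw [fun_eq_iff_fin_three]; simp

/-- Scalar form of `μ = λ − e₁ − e₂`. [folklore] -/
theorem eq_sub_single_one_two_iff :
    μ = lam - Pi.single 1 1 - Pi.single 2 1 ↔ μ 0 = lam 0 ∧ μ 1 = lam 1 - 1 ∧ μ 2 = lam 2 - 1 := by
  rw [fun_eq_iff_fin_three]; simp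

/-- Scalar form of `μ = λ − e₀ − e₂`. [folklore] -/
theorem eq_sub_single_zero_two_iff :
    μ = lam - Pi.single 0 1 - Pi.single 2 1 ↔ μ 0 = lam 0 - 1 ∧ μ 1 = lam 1 ∧ μ 2 = lam 2 - 1 := by
  rw [fun_eq_iff_fin_three]; simp

/-- Scalar form of `μ = λ − e₀ − e₁`. [folklore] -/
theorem eq_sub_single_zero_one_iff :
    μ = lam - Pi.single 0 1 - Pi.single 1 1 ↔ μ 0 = lam 0 - 1 ∧ μ 1 = lam 1 - 1 ∧ μ 2 = lam 2 := by
  rw [fun_eq_iff_fin_three]; simp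

end Sorting

section Closed

variable {K : Type*} [Field K] [ValuativeRel K] [IsDiscreteValuationRing 𝒪[K]] [Finite 𝓀[K]] {ϖ : K}

/-- **GL₃ PIERI COUNTS, `r = 1` (CLOSED FORM).** For antitone `λ, μ : Fin 3 → ℤ` (`q = #𝓀`, `e_i = Pi.single i 1`):
`#{γ ∈ K₀·(t₁K₀) : (γ.out⁻¹ϖ^λ)K₀ ∈ K₀·(ϖ^μK₀)} = [μ = λ−e₂]·(q² + [λ₁=λ₂]·q + [λ₀=λ₁=λ₂]) + [μ = λ−e₁]·(q + [λ₀=λ₁]) + [μ = λ−e₀]`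
— the coefficients of `c_λ` in `c_μ·T₁`, values `q², q²+q, q²+q+1 ∕ q, q+1 ∕ 1`, and `0` off the three vertical strips. [cite: Macdonald1995, Ch. II (4.6); Ch. V (2.6)] -/
theorem ncard_pieri_one_eq (hϖ : IsUniformizingElement ϖ) {lam μ : Fin 3 → ℤ} (hlam : Antitone lam) (hμ : Antitone μ) :
    {γ ∈ MulAction.orbit (glInt 3 K) (((heckeDiag 3 (Units.mk0 ϖ hϖ.ne_zero) 1 : GL (Fin 3) K)) : GL (Fin 3) K ⧸ glInt 3 K) |
        ((((γ.out)⁻¹ * zpowDiagGL hϖ.ne_zero lam : GL (Fin 3) K)) : GL (Fin 3) K ⧸ glInt 3 K) ∈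
          MulAction.orbit (glInt 3 K) (((zpowDiagGL hϖ.ne_zero μ : GL (Fin 3) K)) : GL (Fin 3) K ⧸ glInt 3 K)}.ncard =
      (if μ = lam - Pi.single 2 1 then
          Nat.card 𝓀[K] ^ 2 + (if lam 1 = lam 2 then Nat.card 𝓀[K] else 0) + (if lam 0 = lam 1 ∧ lam 1 = lam 2 then 1 else 0)
        else 0) +
      (if μ = lam - Pi.single 1 1 then Nat.card 𝓀[K] + (if lam 0 = lam 1 then 1 else 0) else 0) +
      (if μ = lam - Pi.single 0 1 then 1 else 0) := by
  classical
  have hl := antitone_fin_three_iff.1 hlam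
  have hm := antitone_fin_three_iff.1 hμ
  rw [ncard_pieri_one_eq_brackets hϖ hlam μ, if_congr (perm_sub_single_two_iff hlam hμ) rfl rfl]
  by_cases h12 : lam 1 = lam 2 <;> by_cases h01 : lam 0 = lam 1
  · rw [if_congr (perm_sub_single_one_iff_of_eq hlam hμ h12) rfl rfl, if_congr (perm_sub_single_zero_iff_of_eq_of_eq hlam hμ h01 h12) rfl rfl]
    simp only [eq_sub_single_two_iff, eq_sub_single_one_iff, eq_sub_single_zero_iff]
    generalize Nat.card 𝓀[K] = q
    split_ifs <;> omega
  · rw [if_congr (perm_sub_single_one_iff_of_eq hlam hμ h12) rfl rfl, if_congr (perm_sub_single_zero_iff_of_ne hlam hμ h01) rfl rfl]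
    simp only [eq_sub_single_two_iff, eq_sub_single_one_iff, eq_sub_single_zero_iff]
    generalize Nat.card 𝓀[K] = q
    split_ifs <;> omega
  · rw [if_congr (perm_sub_single_one_iff_of_ne hlam hμ h12) rfl rfl, if_congr (perm_sub_single_zero_iff_of_eq_of_ne hlam hμ h01 h12) rfl rfl]
    simp only [eq_sub_single_two_iff, eq_sub_single_one_iff, eq_sub_single_zero_iff]
    generalize Nat.card 𝓀[K] = q
    split_ifs <;> omega
  · rw [if_congr (perm_sub_single_one_iff_of_ne hlam hμ h12) rfl rfl, if_congr (perm_sub_single_zero_iff_of_ne hlam hμ h01) rfl rfl]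
    simp only [eq_sub_single_two_iff, eq_sub_single_one_iff, eq_sub_single_zero_iff]
    generalize Nat.card 𝓀[K] = q
    split_ifs <;> omega

/-- **GL₃ PIERI COUNTS, `r = 2` (CLOSED FORM).** For antitone `λ, μ : Fin 3 → ℤ`:
`#{γ ∈ K₀·(t₂K₀) : (γ.out⁻¹ϖ^λ)K₀ ∈ K₀·(ϖ^μK₀)} = [μ = λ−e₁−e₂]·(q² + [λ₀=λ₁]·q + [λ₀=λ₁=λ₂]) + [μ = λ−e₀−e₂]·(q + [λ₁=λ₂]) + [μ = λ−e₀−e₁]`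
— the coefficients of `c_λ` in `c_μ·T₂`. [cite: Macdonald1995, Ch. II (4.6); Ch. V (2.6)] -/
theorem ncard_pieri_two_eq (hϖ : IsUniformizingElement ϖ) {lam μ : Fin 3 → ℤ} (hlam : Antitone lam) (hμ : Antitone μ) :
    {γ ∈ MulAction.orbit (glInt 3 K) (((heckeDiag 3 (Units.mk0 ϖ hϖ.ne_zero) 2 : GL (Fin 3) K)) : GL (Fin 3) K ⧸ glInt 3 K) |
        ((((γ.out)⁻¹ * zpowDiagGL hϖ.ne_zero lam : GL (Fin 3) K)) : GL (Fin 3) K ⧸ glInt 3 K) ∈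
          MulAction.orbit (glInt 3 K) (((zpowDiagGL hϖ.ne_zero μ : GL (Fin 3) K)) : GL (Fin 3) K ⧸ glInt 3 K)}.ncard =
      (if μ = lam - Pi.single 1 1 - Pi.single 2 1 then
          Nat.card 𝓀[K] ^ 2 + (if lam 0 = lam 1 then Nat.card 𝓀[K] else 0) + (if lam 0 = lam 1 ∧ lam 1 = lam 2 then 1 else 0)
        else 0) +
      (if μ = lam - Pi.single 0 1 - Pi.single 2 1 then Nat.card 𝓀[K] + (if lam 1 = lam 2 then 1 else 0) else 0) +
      (if μ = lam - Pi.single 0 1 - Pi.single 1 1 then 1 else 0) := by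
  classical
  have hl := antitone_fin_three_iff.1 hlam
  have hm := antitone_fin_three_iff.1 hμ
  rw [ncard_pieri_two_eq_brackets hϖ hlam μ, if_congr (perm_sub_single_one_two_iff hlam hμ) rfl rfl]
  by_cases h01 : lam 0 = lam 1 <;> by_cases h12 : lam 1 = lam 2
  · rw [if_congr (perm_sub_single_zero_two_iff_of_eq hlam hμ h01) rfl rfl,
      if_congr (perm_sub_single_zero_one_iff_of_eq_of_eq hlam hμ h12 h01) rfl rfl]
    simp only [eq_sub_single_one_two_iff, eq_sub_single_zero_two_iff, eq_sub_single_zero_one_iff]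
    generalize Nat.card 𝓀[K] = q
    split_ifs <;> omega
  · rw [if_congr (perm_sub_single_zero_two_iff_of_eq hlam hμ h01) rfl rfl,
      if_congr (perm_sub_single_zero_one_iff_of_ne hlam hμ h12) rfl rfl]
    simp only [eq_sub_single_one_two_iff, eq_sub_single_zero_two_iff, eq_sub_single_zero_one_iff]
    generalize Nat.card 𝓀[K] = q
    split_ifs <;> omega
  · rw [if_congr (perm_sub_single_zero_two_iff_of_ne hlam hμ h01) rfl rfl,
      if_congr (perm_sub_single_zero_one_iff_of_eq_of_ne hlam hμ h12 h01) rfl rfl]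
    simp only [eq_sub_single_one_two_iff, eq_sub_single_zero_two_iff, eq_sub_single_zero_one_iff]
    generalize Nat.card 𝓀[K] = q
    split_ifs <;> omega
  · rw [if_congr (perm_sub_single_zero_two_iff_of_ne hlam hμ h01) rfl rfl,
      if_congr (perm_sub_single_zero_one_iff_of_ne hlam hμ h12) rfl rfl]
    simp only [eq_sub_single_one_two_iff, eq_sub_single_zero_two_iff, eq_sub_single_zero_one_iff]
    generalize Nat.card 𝓀[K] = q
    split_ifs <;> omega

end Closed


end Summit.HodgeConjecture.HodgeConjecture.R90.S6
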